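import Literature.IUT.HodgeArakelov.ConstantMultipleRigidityDiagramProofs
import Literature.IUT.HodgeArakelov.ThetaEvaluationModelEvTorsion

/-!
# [IUTchII] Cor 1.12 (iii) at the model: the diagram `(†μ,×μ)` for the MODEL theta-evaluation datum — its three inputs
# (`hκ`, `hμ`, the last `≅`) supplied from Kummer theory (proof companion)

Proof-only companion (abc-iut cell, D-0067 wave 4, seat abc-iut-w4-d043 gen 3; node **IUTchII:Cor1.12(iii)**; L6-lead
§F v1.19l «Cor 1.12 (ii)/(iii) at the model = w4-d043») to abc-iut-L6-t1's `ConstantMultipleRigidity.lean` (the typed DATA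
`MuXmuDiagram Ev A G Q κ` of the diagram `(†μ,×μ)`), abc-iut-w4-d041's `ConstantMultipleRigidityDiagramProofs.lean` (its
ABSTRACT existence `ThetaEvaluation.nonempty_muXmuDiagram` from three inputs `hκ`, `hμ`, `P₄₅`) and abc-iut-w4-d043's model
datum `EtaleLevels.thetaEvaluation` (`ThetaEvaluationModelEvInstance.lean`).  No definition, no `Prop`-valued fact.

S. Mochizuki, *Inter-universal Teichmüller theory II*, kurims manuscript (Dec. 2020), Cor. 1.12 (iii), p. 58 (verbatim):
"the diagram `Π_μ(M^Θ_*(Π)) ⊗ ℚ/ℤ ≅ M^μ_TM(M^Θ_*(Π)) ≅ M^μ_TM(Π) → M^{×μ}_TM(Π) ≅ O^{×μ}(G)` `(†μ,×μ)` — where the first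
`≅` is the isomorphism determined by the injection of Remark 1.5.2; the second `≅` is the isomorphism determined by the
vertical arrows of `(†×θ)(Π)`; the `→` is the trivial homomorphism; the final `≅` denotes the poly-isomorphism induced by
the poly-isomorphism `α_×` of Example 1.8, (iii) [cf. also the discussion of `Γ^{×μ}` in Example 1.8, (iv)]."; Ex. 1.8
(iii), p. 38: "`α_× : (Π ↷ M^×_TM(Π)) ≅ (G ↷ O^×(G))|_Π` determined by the `Γ`-orbit of the poly-isomorphism `α_⊳|_×`
induced by the poly-isomorphism `α_⊳` of (ii)", the latter "determined … by the composite of the natural surjection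
`Π ↠ Π/Δ` with the full poly-isomorphism of topological groups `Π/Δ ≅ G`" (p. 37); Cor. 1.12 (c)/(d), p. 56: "one has a
natural inclusion `M^×_TM(Π) ↪ lim_J H¹(J,(l·Δ_Θ)(Π))`" / "`M^μ_TM(−) ⊆ M^×_TM(−)` denotes the submodule of torsion
elements".  Claim key `Mochizuki2012` (D-0012, DISPUTED); what is proved here is Kummer theory + abelian-group algebra over
the typed interface and takes no side on [IUTchIII] Cor. 3.12.

WHAT IS PROVED, for the model datum `Ev := EtaleLevels.thetaEvaluation …` over `Π := Π^tp_{X̲̲}` (REAL continuous cohomology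
of `(l·Δ_Θ)`; `M^×_TM(Π) :=` the Kummer image of the unit constants `U` at the decomposition group `D_{μ_-}`; `inclHd :=`
the inflation section):
* `EtaleLevels.torsion_mem_map_MxTM_thetaEvaluation` — the input `hμ` of `nonempty_muXmuDiagram` ON THE FIRST LINE
  `lim_J H¹(Π_Ÿ(Π)|_J,(l·Δ_Θ)(Π))`: every torsion class there is (the inflation of) a unit class, from Kummer theory
  (abc-iut-w5-d098 `exists_mem_h1LimKummer_eq_of_isOfFinAddOrder` at `Π_Ÿ`) and `LevelRetraction.h1LimSection_image_kummer`
  (abc-iut-w4-d043), given `hc` (bijective change-of-coefficients cyclotome, Cor. 1.11 (a)) and `hU` (`U ⊇` roots of unity);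
* `ThetaEnvData.rmk152_kummerTorsion_torsion` — the input `hκ` with `Q :=` THE torsion subgroup of
  `lim_J H¹(Π_Ÿ(M^Θ_*)|_J, Π_μ(M^Θ_*))` and `κ :=` its inclusion (canonical up to UNIQUE isomorphism: any Rmk. 1.5.2 datum
  `(Q', κ')` factors uniquely through it, and `MuXmuDiagram.e₁₂_unique`);
* `EtaleLevels.exists_mulEquiv_unitsModTorsion_MxmuTM` — the Kummer identification BUILT, not assumed: for the Kummer map
  `κ_D` injective on the constants (at the model: abc-iut-w4-d007 `h1LimKummer_injective_of_coeff`, from `hc` and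
  `[G_{ℚ_p} : ε(D_{μ_-})] < ∞`) an isomorphism `U/μ(U) ≅ M^{×μ}_TM(Π)` carrying `u` to the class of `κ_D u`;
* `EtaleLevels.exists_muXmuDiagram_thetaEvaluation` — hence, for ANY [AbsTopIII]-output interface `A` and `G ≅ G_k` and
  any non-empty collection `P₀` of identifications `U/μ(U) ≅ O^{×μ}(G)` (print: the `α_×`-induced ones — for the GENUINE
  producer `AbsTopMonoids.genuineOfModel` of abc-iut-L6-t13, `O^×(G) = 𝒪^×_{k̄}` IS the unit constants and `P₀` is the
  `Aut`-orbit of the identity), the diagram `(†μ,×μ)` EXISTS with its last arrow EQUAL TO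
  `{π ∘ (Kummer identification)⁻¹ | π ∈ P₀}` — all four arrows pinned (`e₁₂_unique`, `e₂₃_unique`, the trivial `→`, and
  this equation);
* `EtaleLevels.cor112_iii_model` — the fully concrete instance: constants `ℚ̄_pˣ` through `ε` (abc-iut-w4-d007), `U :=
  𝒪^×_{ℚ̄_p} = unitGroup ℚ_[p] (PadicAlgCl p)` (abc-iut-L4), canonical retractions `LevelRetraction.ofAugmentation ε D_{μ_-}`,
  any pointed inversion `I` (so in particular abc-iut-w5-d072's `pointedInversionOfPair`, the `Ev` of
  `cor112_ii_model_unitGroup`): residual NAMED inputs = `hcU` (bijective cyclotomic rigidity datum `Λ(ℚ̄_pˣ) ⥲ (l·Δ_Θ)`,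
  Cor. 1.11 (a)), `[G_{ℚ_p} : ε(D_{μ_-})] < ∞` + `hDq`/`hlift`/`hemb` ([SemiAnbd] §6 decomposition-group facts), and `P₀`.
HONEST FRAMING: nothing here asserts that abc is proved or refuted; typed ≠ discharged; instantiated ≠ endorsed.
-/

noncomputable section

namespace Literature.IUT.HodgeArakelov

universe u

/-! ### The input `hκ`: the torsion subgroup with its inclusion is a Remark 1.5.2 datum -/

/-- **The canonical Remark 1.5.2 datum**: for ANY `θ_env`-data `T`, the torsion subgroup of
`lim_J H¹(Π_Ÿ(M^Θ_*)|_J, Π_μ(M^Θ_*))` with its inclusion satisfies abc-iut-L6-t1's `Rmk152_kummerTorsion` ("a natural …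
injection … whose image is equal to the torsion subgroup of the codomain", kurims pp. 30–31) — the input `hκ` of
`ThetaEvaluation.nonempty_muXmuDiagram`. [claim: Mochizuki2012, status: disputed] (IUTchII §1 Rmk 1.5.2, kurims pp.30-31) -/
theorem ThetaEnvData.rmk152_kummerTorsion_torsion {S : ThetaSetting.{u}} {F : ModelFamily S} {Sys : MonoThetaProjSystem F}
    (T : ThetaEnvData Sys) :
    Rmk152_kummerTorsion T ↥(AddCommGroup.torsion T.cohEnv.lim) (AddCommGroup.torsion T.cohEnv.lim).subtype := by
  refine ⟨AddSubgroup.subtype_injective _, Set.ext fun x => ⟨?_, fun hx => ?_⟩⟩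
  · rintro ⟨y, rfl⟩
    exact (AddCommGroup.mem_torsion _).mp y.2
  · exact ⟨⟨x, (AddCommGroup.mem_torsion _).mpr hx⟩, rfl⟩

/-- … and it is canonical: ANY Remark 1.5.2 datum `(Q, κ)` is carried isomorphically onto the torsion subgroup by `κ`
(unique factorisation through the inclusion). [claim: Mochizuki2012, status: disputed] (IUTchII §1 Rmk 1.5.2, kurims pp.30-31) -/
theorem ThetaEnvData.rmk152_kummerTorsion_factor {S : ThetaSetting.{u}} {F : ModelFamily S} {Sys : MonoThetaProjSystem F}
    (T : ThetaEnvData Sys) {Q : Type u} [AddCommGroup Q] {κ : Q →+ T.cohEnv.lim} (hκ : Rmk152_kummerTorsion T Q κ) :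
    ∃! e : Q ≃+ ↥(AddCommGroup.torsion T.cohEnv.lim), ∀ q, ((e q : ↥(AddCommGroup.torsion T.cohEnv.lim)) : T.cohEnv.lim) = κ q := by
  have hmem : ∀ q, κ q ∈ AddCommGroup.torsion T.cohEnv.lim := fun q =>
    (AddCommGroup.mem_torsion _).mpr (by have h : κ q ∈ Set.range κ := ⟨q, rfl⟩; rw [hκ.2] at h; exact h)
  let κ' : Q →+ ↥(AddCommGroup.torsion T.cohEnv.lim) := κ.codRestrict _ hmem
  have hinj : Function.Injective κ' := fun a b h => hκ.1 (congrArg Subtype.val h)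
  have hsurj : Function.Surjective κ' := by
    intro y
    have hy : (y : T.cohEnv.lim) ∈ Set.range κ := by rw [hκ.2]; exact (AddCommGroup.mem_torsion _).mp y.2
    obtain ⟨q, hq⟩ := hy
    exact ⟨q, Subtype.ext hq⟩
  refine ⟨AddEquiv.ofBijective κ' ⟨hinj, hsurj⟩, fun q => rfl, fun e he => ?_⟩
  ext q
  exact he q

open Literature.AnabelianGeometry.EtaleTheta Literature.AnabelianGeometry.SemiGraphs CohomologySystemOfContH1
open Literature.AnabelianGeometry.AbsoluteAnabelian
open scoped Literature.AnabelianGeometry.EtaleTheta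

namespace EtaleLevels

variable {p : ℕ} [Fact p.Prime] {D : Literature.AnabelianGeometry.EtaleTheta.ThetaSetting p}
  {E : D.EtaleThetaData} {l : ℕ} (C : E.DoubleUnderline l) (hC : D.Compat) (hS : D.Sec2Hyps)
  (hl : l.Prime) (hp2 : p ≠ 2) (hpl : p ≠ l) (hζ : ∃ ζ : D.K, IsPrimitiveRoot ζ (4 * l))
  (mods : ∀ M : ℕ+, D.CyclotomeMod l M)
  (f : contCocycles D.toTheta D.DeltaTheta C.GtpYdduu) (hf : f ∈ C.rootCocycles hC)
  (hmods : ∀ (M M' : ℕ+) (h : (M : ℕ) ∣ (M' : ℕ)) (x : D.lDeltaTheta l),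
    MuN.red p M M' h ((mods M').red x) = (mods M).red x)
  (h15 : Literature.AnabelianGeometry.EtaleTheta.ThetaSetting.Prop15iii E hC) (L : C.CuspLabels)
  (hZ : ∀ M : ℕ+, Nonempty (ModelCyclotomes.lDeltaQuot (C.rigidData (mods M) hC hS h15 L) ≃*
    Literature.IUT.HodgeTheaters.ZHat))
  (hcharY : EtaleThetaDataOfSetting.PiYddCharacteristic C)
  (hlim : Function.Bijective (rigidLimHom C hC hS hl hp2 hpl hζ mods f hf hmods h15 L hZ))
  (Env : EnvOfGroup (setting C hC hS hl hp2 hpl hζ mods f hf)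
    (modelSystem C hC hS hl hp2 hpl hζ mods f hf hmods h15 L hZ).PiX)
  (I : PointedInversion Env (thetaEnvData C hC hS hl hp2 hpl hζ mods f hf hmods h15 L hZ hcharY hlim).D)

section Generic

variable
  (R : LevelRetraction (EtaleThetaDataOfSetting.phi C) (D.lDeltaTheta l) (EtaleThetaDataOfSetting.PiYdd C) I.Dmu)
  {Aroot : Type} [CommGroup Aroot] [MulDistribMulAction (EtaleThetaDataOfSetting.Pi C) Aroot]
  [TopologicalSpace Aroot] [RootableBy Aroot ℕ]
  (c : CyclotomeCoefficients (EtaleThetaDataOfSetting.phi C) (D.lDeltaTheta l) Aroot)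
  (hA : ∀ b : Aroot, IsOpen (MulAction.stabilizer (EtaleThetaDataOfSetting.Pi C) b :
    Set (EtaleThetaDataOfSetting.Pi C)))
  (hfi : ∀ b : Aroot, (MulAction.stabilizer (EtaleThetaDataOfSetting.Pi C) b).FiniteIndex)
  (U : Subgroup Aroot)
  (ρlim : (EtaleThetaDataOfSetting.coh C).lim ≃+ (EtaleThetaDataOfSetting.coh C).lim)

/-! ### The input `hμ` on the first line `lim_J H¹(Π_Ÿ(Π)|_J, (l·Δ_Θ)(Π))` -/

/-- **The input `hμ` of `nonempty_muXmuDiagram` HOLDS for the model datum**: every TORSION class of the first line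
`lim_J H¹(Π_Ÿ(Π)|_J,(l·Δ_Θ)(Π))` of `(†×θ)(Π)` lies in the image `inclHd(M^×_TM(Π))` of the unit classes — i.e. "`M^μ_TM(−)`,
the submodule of torsion elements" of Cor. 1.12 (d), p. 56, is ALL the torsion of the ambient limit, as the first `≅` of
`(†μ,×μ)` requires. From Kummer theory at `Π_Ÿ` (abc-iut-w5-d098: a torsion class is the Kummer class of a root of unity,
given the bijective change-of-coefficients cyclotome `hc`, Cor. 1.11 (a)), `hU` (`U` contains the roots of unity; print
`U = 𝒪^×_{k̄}`), and "the inflation section carries `κ_D(U)` onto `κ_{Π_Ÿ}(U)`" (`h1LimSection_image_kummer`, under the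
retraction/action compatibility `hψA`). [claim: Mochizuki2012, status: disputed] (IUTchII §1 Cor 1.12 (iii), kurims pp.56-58) -/
theorem torsion_mem_map_MxTM_thetaEvaluation
    (hψA : ∀ i (k : ↥(EtaleThetaDataOfSetting.PiYdd C ⊓ (R.lift i).K)) (b : Aroot),
      ((R.ψ i k : ↥(I.Dmu ⊓ i.K)) : EtaleThetaDataOfSetting.Pi C) • b = (k : EtaleThetaDataOfSetting.Pi C) • b)
    (hc : Function.Bijective c.hom) (hU : ∀ u : Aroot, IsOfFinOrder u → u ∈ U)
    (x : h1Lim (EtaleThetaDataOfSetting.phi C) (D.lDeltaTheta l) (EtaleThetaDataOfSetting.PiYdd C) ⊥)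
    (hx : IsOfFinAddOrder x) :
    x ∈ (thetaEvaluation C hC hS hl hp2 hpl hζ mods f hf hmods h15 L hZ hcharY hlim Env I R c hA hfi U ρlim).MxTM.map
      (thetaEvaluation C hC hS hl hp2 hpl hζ mods f hf hmods h15 L hZ hcharY hlim Env I R c hA hfi U ρlim).inclHd := by
  -- the torsion class `x` is the `Π_Ÿ`-Kummer class of some `u ∈ U`
  obtain ⟨u, hu, hux⟩ := CohomologySystemOfContH1.exists_mem_h1LimKummer_eq_of_isOfFinAddOrder
    (EtaleThetaDataOfSetting.phi C) (D.lDeltaTheta l) (EtaleThetaDataOfSetting.PiYdd C) c hA hfi hc U hU x hx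
  have hxU : x ∈ (AddSubgroup.toSubgroup.symm (U.map (h1LimKummer (EtaleThetaDataOfSetting.phi C) (D.lDeltaTheta l)
      (EtaleThetaDataOfSetting.PiYdd C) c hA hfi)) :
        Set (h1Lim (EtaleThetaDataOfSetting.phi C) (D.lDeltaTheta l) (EtaleThetaDataOfSetting.PiYdd C) ⊥)) := by
    change Multiplicative.ofAdd x ∈ U.map _
    exact Subgroup.mem_map.mpr ⟨u, hu, hux⟩
  -- … hence the inflation of a `D`-Kummer class of `U`
  rw [← R.h1LimSection_image_kummer c hA hfi hψA U] at hxU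
  obtain ⟨m, hm, hmx⟩ := hxU
  exact AddSubgroup.mem_map.mpr ⟨m, hm, hmx⟩

/-! ### The last `≅`: the Kummer identification `U/μ(U) ≅ M^{×μ}_TM(Π)`, BUILT -/

/-- **The Kummer identification of the unit constants with the unit classes, modulo torsion** (Cor. 1.12 (c), p. 56: "a
natural inclusion `M^×_TM(Π) ↪ lim_J H¹(J,(l·Δ_Θ)(Π))`" — at the model `M^×_TM(Π)` IS the Kummer image of `U`): if the Kummer
map `κ_D` at `D_{μ_-}` is injective, there is an isomorphism of groups `U/μ(U) ≅ M^{×μ}_TM(Π) = M^×_TM(Π)/M^μ_TM(Π)` carrying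
the class of `u ∈ U` to the class of its Kummer class `κ_D u`.
[claim: Mochizuki2012, status: disputed] (IUTchII §1 Cor 1.12 (iii), kurims pp.56-58) -/
theorem exists_mulEquiv_unitsModTorsion_MxmuTM
    (hinj : Function.Injective (h1LimKummer (EtaleThetaDataOfSetting.phi C) (D.lDeltaTheta l) I.Dmu c hA hfi)) :
    ∃ e : (↥U ⧸ CommGroup.torsion ↥U) ≃*
        Multiplicative (thetaEvaluation C hC hS hl hp2 hpl hζ mods f hf hmods h15 L hZ hcharY hlim Env I R c hA hfi U
          ρlim).MxmuTM,
      ∀ (u : ↥U) (m : ↥(thetaEvaluation C hC hS hl hp2 hpl hζ mods f hf hmods h15 L hZ hcharY hlim Env I R c hA hfi U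
          ρlim).MxTM),
        (m : (thetaEvaluation C hC hS hl hp2 hpl hζ mods f hf hmods h15 L hZ hcharY hlim Env I R c hA hfi U ρlim).Hd) =
            Multiplicative.toAdd (h1LimKummer (EtaleThetaDataOfSetting.phi C) (D.lDeltaTheta l) I.Dmu c hA hfi u) →
          e (QuotientGroup.mk u) = Multiplicative.ofAdd (QuotientAddGroup.mk m) := by
  classical
  -- abbreviations
  let Ev := thetaEvaluation C hC hS hl hp2 hpl hζ mods f hf hmods h15 L hZ hcharY hlim Env I R c hA hfi U ρlim
  let κ := h1LimKummer (EtaleThetaDataOfSetting.phi C) (D.lDeltaTheta l) I.Dmu c hA hfi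
  have hmem : ∀ u : ↥U, Multiplicative.toAdd (κ u) ∈ Ev.MxTM := fun u =>
    (mem_thetaEvaluation_MxTM C hC hS hl hp2 hpl hζ mods f hf hmods h15 L hZ hcharY hlim Env I R c hA hfi U ρlim _).mpr
      ⟨u, u.2, rfl⟩
  -- the Kummer map of `U` onto the unit classes, as a monoid hom into `Multiplicative M^×_TM(Π)`
  let κU : ↥U →* Multiplicative ↥Ev.MxTM :=
    { toFun := fun u => Multiplicative.ofAdd ⟨Multiplicative.toAdd (κ u), hmem u⟩
      map_one' := by
        apply Multiplicative.toAdd.injective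
        apply Subtype.ext
        change Multiplicative.toAdd (κ ((1 : ↥U) : Aroot)) = ((0 : ↥Ev.MxTM) : Ev.Hd)
        rw [OneMemClass.coe_one, map_one]
        rfl
      map_mul' := fun u v => by
        apply Multiplicative.toAdd.injective
        apply Subtype.ext
        change Multiplicative.toAdd (κ ((u * v : ↥U) : Aroot)) =
          Multiplicative.toAdd (κ (u : Aroot)) + Multiplicative.toAdd (κ (v : Aroot))
        rw [Subgroup.coe_mul, map_mul]
        rfl }
  -- followed by the quotient by the torsion
  let π : Multiplicative ↥Ev.MxTM →* Multiplicative Ev.MxmuTM :=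
    AddMonoidHom.toMultiplicative (QuotientAddGroup.mk' (AddCommGroup.torsion ↥Ev.MxTM))
  have hπ : ∀ m : ↥Ev.MxTM, π (Multiplicative.ofAdd m) = Multiplicative.ofAdd (QuotientAddGroup.mk m) := fun m => rfl
  let φ : ↥U →* Multiplicative Ev.MxmuTM := π.comp κU
  have hφ : ∀ u : ↥U, φ u = Multiplicative.ofAdd (QuotientAddGroup.mk ⟨Multiplicative.toAdd (κ u), hmem u⟩) :=
    fun u => rfl
  -- `φ` kills the torsion of `U`
  have hker : CommGroup.torsion ↥U ≤ φ.ker := by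
    intro u hu
    rw [MonoidHom.mem_ker, hφ]
    apply Multiplicative.toAdd.injective
    rw [toAdd_ofAdd, toAdd_one, QuotientAddGroup.eq_zero_iff, AddCommGroup.mem_torsion]
    have h1 : IsOfFinOrder (κU u) := κU.isOfFinOrder ((CommGroup.mem_torsion _).mp hu)
    have h2 : IsOfFinAddOrder (Multiplicative.toAdd (κU u)) :=
      isOfFinOrder_ofAdd_iff.mp (by rw [ofAdd_toAdd]; exact h1)
    exact h2
  let ψ : (↥U ⧸ CommGroup.torsion ↥U) →* Multiplicative Ev.MxmuTM := QuotientGroup.lift _ φ hker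
  have hψ : ∀ u : ↥U, ψ (QuotientGroup.mk u) =
      Multiplicative.ofAdd (QuotientAddGroup.mk ⟨Multiplicative.toAdd (κ u), hmem u⟩) := fun u =>
    (QuotientGroup.lift_mk _ hker u).trans (hφ u)
  -- `ψ` is injective: a unit whose Kummer class is torsion is torsion (Kummer map injective)
  have hψinj : Function.Injective ψ := by
    refine (injective_iff_map_eq_one ψ).mpr fun q hq => ?_
    induction q using QuotientGroup.induction_on with
    | H u =>
      rw [hψ] at hq
      have hq' : (QuotientAddGroup.mk (⟨Multiplicative.toAdd (κ u), hmem u⟩ : ↥Ev.MxTM) : Ev.MxmuTM) = 0 :=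
        Multiplicative.ofAdd.injective (hq.trans rfl)
      rw [QuotientAddGroup.eq_zero_iff, AddCommGroup.mem_torsion] at hq'
      have h1 : IsOfFinAddOrder (Multiplicative.toAdd (κ u)) := Ev.MxTM.subtype.isOfFinAddOrder hq'
      have h2 : IsOfFinOrder (κ u) := by
        have h := isOfFinOrder_ofAdd_iff.mpr h1
        rwa [ofAdd_toAdd] at h
      have h3 : IsOfFinOrder ((u : ↥U) : Aroot) := (hinj.isOfFinOrder_iff).mp h2
      have h4 : IsOfFinOrder u := ((Subgroup.subtype_injective U).isOfFinOrder_iff (f := U.subtype)).mp h3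
      exact (QuotientGroup.eq_one_iff _).mpr ((CommGroup.mem_torsion _).mpr h4)
  -- `ψ` is surjective: `M^×_TM(Π)` is the Kummer image of `U`
  have hψsurj : Function.Surjective ψ := by
    intro y
    obtain ⟨m, hm⟩ : ∃ m : ↥Ev.MxTM, Multiplicative.ofAdd (QuotientAddGroup.mk m) = y := by
      obtain ⟨m, hm⟩ := QuotientAddGroup.mk_surjective (Multiplicative.toAdd y)
      exact ⟨m, by rw [hm, ofAdd_toAdd]⟩
    obtain ⟨u, hu, hum⟩ :=
      (mem_thetaEvaluation_MxTM C hC hS hl hp2 hpl hζ mods f hf hmods h15 L hZ hcharY hlim Env I R c hA hfi U ρlim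
        (m : Ev.Hd)).mp m.2
    refine ⟨QuotientGroup.mk ⟨u, hu⟩, ?_⟩
    rw [hψ, ← hm]
    congr 2
    apply Subtype.ext
    change Multiplicative.toAdd (κ u) = (m : Ev.Hd)
    rw [hum]
    rfl
  refine ⟨MulEquiv.ofBijective ψ ⟨hψinj, hψsurj⟩, fun u m hm => ?_⟩
  rw [MulEquiv.ofBijective_apply, hψ]
  congr 2
  exact Subtype.ext hm.symm

/-! ### The diagram `(†μ,×μ)` for the model datum -/

/-- **[IUTchII] Cor 1.12 (iii) — the diagram `(†μ,×μ)` EXISTS for the model theta-evaluation datum, with all four arrows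
pinned.** For `Ev := EtaleLevels.thetaEvaluation …` (`Π := Π^tp_{X̲̲}`, REAL continuous cohomology of `(l·Δ_Θ)`,
`M^×_TM(Π) :=` the Kummer image of the unit constants `U` at `D_{μ_-}`, `inclHd :=` the inflation section of `R`), ANY
[AbsTopIII]-output interface `A` with `G ≅ G_k`, and any non-empty collection `P₀` of identifications `U/μ(U) ≅ O^{×μ}(G)`
("induced by the poly-isomorphism `α_×` of Example 1.8, (iii)" — for the genuine producer, `O^×(G)` IS the unit constants):
there is a `MuXmuDiagram Ev A G Q κ` with `Q :=` the torsion subgroup of `lim_J H¹(Π_Ÿ(M^Θ_*)|_J, Π_μ(M^Θ_*))`, `κ :=` its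
inclusion (the Rmk. 1.5.2 injection, `ThetaEnvData.rmk152_kummerTorsion_torsion`), whose last arrow `poly₄₅` IS the set
`{π ∘ (Kummer identification U/μ(U) ≅ M^{×μ}_TM(Π))⁻¹ | π ∈ P₀}`; the first two `≅` are unique (`MuXmuDiagram.e₁₂_unique`,
`.e₂₃_unique`) and the `→` is trivial (`ThetaEvaluation.mmuTM_to_mxmuTM_eq_zero`). Inputs: `hψA` (retractions respect the
action on the constants), `hc` (bijective cyclotome coefficients, Cor. 1.11 (a)), `hU` (`U ⊇` roots of unity), `hinj` (Kummer
map at `D_{μ_-}` injective). [claim: Mochizuki2012, status: disputed] (IUTchII §1 Cor 1.12 (iii), kurims p.58) -/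
theorem exists_muXmuDiagram_thetaEvaluation
    (hψA : ∀ i (k : ↥(EtaleThetaDataOfSetting.PiYdd C ⊓ (R.lift i).K)) (b : Aroot),
      ((R.ψ i k : ↥(I.Dmu ⊓ i.K)) : EtaleThetaDataOfSetting.Pi C) • b = (k : EtaleThetaDataOfSetting.Pi C) • b)
    (hc : Function.Bijective c.hom) (hU : ∀ u : Aroot, IsOfFinOrder u → u ∈ U)
    (hinj : Function.Injective (h1LimKummer (EtaleThetaDataOfSetting.phi C) (D.lDeltaTheta l) I.Dmu c hA hfi))
    (A : AbsTopMonoids (setting C hC hS hl hp2 hpl hζ mods f hf)) (G : IsoClass (setting C hC hS hl hp2 hpl hζ mods f hf).Gk)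
    (P₀ : Set ((↥U ⧸ CommGroup.torsion ↥U) ≃* A.Oxmu G)) (hP₀ : P₀.Nonempty) :
    ∃ Δ : MuXmuDiagram
        (thetaEvaluation C hC hS hl hp2 hpl hζ mods f hf hmods h15 L hZ hcharY hlim Env I R c hA hfi U ρlim) A G
        ↥(AddCommGroup.torsion (thetaEnvData C hC hS hl hp2 hpl hζ mods f hf hmods h15 L hZ hcharY hlim).cohEnv.lim)
        (AddCommGroup.torsion (thetaEnvData C hC hS hl hp2 hpl hζ mods f hf hmods h15 L hZ hcharY hlim).cohEnv.lim).subtype,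
      Δ.poly₄₅ = {e | ∃ π ∈ P₀,
        ∀ (u : ↥U) (m : ↥(thetaEvaluation C hC hS hl hp2 hpl hζ mods f hf hmods h15 L hZ hcharY hlim Env I R c hA hfi U
            ρlim).MxTM),
          (m : (thetaEvaluation C hC hS hl hp2 hpl hζ mods f hf hmods h15 L hZ hcharY hlim Env I R c hA hfi U ρlim).Hd) =
              Multiplicative.toAdd (h1LimKummer (EtaleThetaDataOfSetting.phi C) (D.lDeltaTheta l) I.Dmu c hA hfi u) →
            e (Multiplicative.ofAdd (QuotientAddGroup.mk m)) = π (QuotientGroup.mk u)} := by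
  classical
  let Ev := thetaEvaluation C hC hS hl hp2 hpl hζ mods f hf hmods h15 L hZ hcharY hlim Env I R c hA hfi U ρlim
  let T := thetaEnvData C hC hS hl hp2 hpl hζ mods f hf hmods h15 L hZ hcharY hlim
  -- the Kummer identification
  obtain ⟨eK, heK⟩ := exists_mulEquiv_unitsModTorsion_MxmuTM C hC hS hl hp2 hpl hζ mods f hf hmods h15 L hZ hcharY hlim
    Env I R c hA hfi U ρlim hinj
  -- the last arrow: `π ∘ eK⁻¹`, `π ∈ P₀`
  let P : Set (Multiplicative Ev.MxmuTM ≃* A.Oxmu G) := {e | ∃ π ∈ P₀,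
    ∀ (u : ↥U) (m : ↥Ev.MxTM), (m : Ev.Hd) =
        Multiplicative.toAdd (h1LimKummer (EtaleThetaDataOfSetting.phi C) (D.lDeltaTheta l) I.Dmu c hA hfi u) →
      e (Multiplicative.ofAdd (QuotientAddGroup.mk m)) = π (QuotientGroup.mk u)}
  have hP : P.Nonempty := by
    obtain ⟨π, hπ⟩ := hP₀
    refine ⟨eK.symm.trans π, π, hπ, fun u m hm => ?_⟩
    rw [MulEquiv.trans_apply, ← heK u m hm, MulEquiv.symm_apply_apply]
  -- the first three arrows from abc-iut-w4-d041's abstract existence, with `hκ`, `hμ` discharged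
  obtain ⟨Δ₀⟩ := ThetaEvaluation.nonempty_muXmuDiagram Ev A G (T.rmk152_kummerTorsion_torsion)
    (torsion_mem_map_MxTM_thetaEvaluation C hC hS hl hp2 hpl hζ mods f hf hmods h15 L hZ hcharY hlim Env I R c hA hfi U
      ρlim hψA hc hU) P hP
  exact ⟨{ Δ₀ with poly₄₅ := P, poly₄₅_nonempty := hP }, rfl⟩

end Generic

/-! ### The fully concrete instance: constants `ℚ̄_pˣ` through `ε`, `U := 𝒪^×_{ℚ̄_p}`, canonical retractions -/

section Model

variable
  (hDq : ∀ d ∈ I.Dmu, EtaleThetaDataOfSetting.aug C d = 1 → d = 1)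
  (hlift : ∀ K : Subgroup (EtaleThetaDataOfSetting.Pi C), K.FiniteIndex → IsOpen (K : Set (EtaleThetaDataOfSetting.Pi C)) →
    (liftSubgroup (EtaleThetaDataOfSetting.aug C) I.Dmu K).FiniteIndex ∧
      IsOpen (liftSubgroup (EtaleThetaDataOfSetting.aug C) I.Dmu K : Set (EtaleThetaDataOfSetting.Pi C)))
  (hemb : ∀ K : Subgroup (EtaleThetaDataOfSetting.Pi C),
    Topology.IsEmbedding fun d : ↥(I.Dmu ⊓ K) => EtaleThetaDataOfSetting.aug C d.1)
  (cU : CyclotomeCoefficients (EtaleThetaDataOfSetting.phi C) (D.lDeltaTheta l) (PadicAlgCl p)ˣ)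
  (ρlim : (EtaleThetaDataOfSetting.coh C).lim ≃+ (EtaleThetaDataOfSetting.coh C).lim)

/-- **[IUTchII] Cor 1.12 (iii) AT THE MODEL.** For `Π := Π^tp_{X̲̲}` with REAL continuous cohomology of `(l·Δ_Θ)`,
abc-iut-w4-d030's `θ_env`-data, ANY pointed inversion `I` (in particular abc-iut-w5-d072's `pointedInversionOfPair`, the
datum of `cor112_ii_model_unitGroup`), the theta-evaluation datum `EtaleLevels.thetaEvaluation` with constants `ℚ̄_pˣ` acted
on through `ε` (abc-iut-w4-d007), `U := 𝒪^×_{ℚ̄_p} = unitGroup ℚ_[p] (PadicAlgCl p)` (abc-iut-L4, [AbsTopIII] Def. 3.1 (i)),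
`inclHd :=` the inflation section of the CANONICAL retractions `LevelRetraction.ofAugmentation ε D_{μ_-}` and any `iotaLim`:
for every [AbsTopIII]-output interface `A`, `G ≅ G_k` and non-empty collection `P₀` of identifications
`𝒪^×_{ℚ̄_p}/μ ≅ O^{×μ}(G)` (the `α_×`-induced ones), THE DIAGRAM `(†μ,×μ)` EXISTS — `MuXmuDiagram Ev A G Q κ` with `Q :=` the
torsion of `lim_J H¹(Π_Ÿ(M^Θ_*)|_J, Π_μ(M^Θ_*))`, `κ :=` its inclusion — with last arrow `= {π ∘ (Kummer identification)⁻¹ |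
π ∈ P₀}`. DISCHARGED in the kernel: `hκ` (torsion subgroup), `hμ` (Kummer theory of MLF + inflation section), the Kummer
identification `𝒪^×_{ℚ̄_p}/μ ≅ M^{×μ}_TM(Π)` (abc-iut-w4-d007's injectivity of the Kummer map at `D_{μ_-}`), `hψA` (the action
factors through `ε`), `hU` (roots of unity are units, abc-iut-w5-d205). RESIDUAL NAMED INPUTS: `hcU` (the cyclotomic rigidity
datum `Λ(ℚ̄_pˣ) = Ẑ(1) ⥲ (l·Δ_Θ)` is bijective, Cor. 1.11 (a)), `[G_{ℚ_p} : ε(D_{μ_-})] < ∞` and `hDq`/`hlift`/`hemb`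
([SemiAnbd] §6: `D_{μ_-} ∩ Δ = 1`, `D_{μ_-}` surjects onto an open subgroup), and `P₀`.
[claim: Mochizuki2012, status: disputed] (IUTchII §1 Cor 1.12 (iii), kurims p.58) -/
theorem cor112_iii_model [(Subgroup.map (EtaleThetaDataOfSetting.aug C) I.Dmu).FiniteIndex]
    (hcU : Function.Bijective cU.hom)
    (A : AbsTopMonoids (setting C hC hS hl hp2 hpl hζ mods f hf)) (G : IsoClass (setting C hC hS hl hp2 hpl hζ mods f hf).Gk)
    (P₀ : Set ((↥(unitGroup ℚ_[p] (PadicAlgCl p)) ⧸ CommGroup.torsion ↥(unitGroup ℚ_[p] (PadicAlgCl p))) ≃* A.Oxmu G))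
    (hP₀ : P₀.Nonempty) :
    ∃ Δ : MuXmuDiagram
        (thetaEvaluation C hC hS hl hp2 hpl hζ mods f hf hmods h15 L hZ hcharY hlim Env I
          (LevelRetraction.ofAugmentation (EtaleThetaDataOfSetting.phi C) (D.lDeltaTheta l)
            (EtaleThetaDataOfSetting.aug C) I.Dmu hDq (EtaleThetaDataOfSetting.PiYdd C)
            (EtaleThetaDataOfSetting.continuous_aug C) (aug_ker_acts_trivially C) hlift hemb)
          cU (EtaleThetaDataOfSetting.isOpen_stabilizer_units C) (EtaleThetaDataOfSetting.finiteIndex_stabilizer_units C)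
          (unitGroup ℚ_[p] (PadicAlgCl p)) ρlim) A G
        ↥(AddCommGroup.torsion (thetaEnvData C hC hS hl hp2 hpl hζ mods f hf hmods h15 L hZ hcharY hlim).cohEnv.lim)
        (AddCommGroup.torsion (thetaEnvData C hC hS hl hp2 hpl hζ mods f hf hmods h15 L hZ hcharY hlim).cohEnv.lim).subtype,
      Δ.poly₄₅ = {e | ∃ π ∈ P₀,
        ∀ (u : ↥(unitGroup ℚ_[p] (PadicAlgCl p)))
          (m : ↥(thetaEvaluation C hC hS hl hp2 hpl hζ mods f hf hmods h15 L hZ hcharY hlim Env I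
            (LevelRetraction.ofAugmentation (EtaleThetaDataOfSetting.phi C) (D.lDeltaTheta l)
              (EtaleThetaDataOfSetting.aug C) I.Dmu hDq (EtaleThetaDataOfSetting.PiYdd C)
              (EtaleThetaDataOfSetting.continuous_aug C) (aug_ker_acts_trivially C) hlift hemb)
            cU (EtaleThetaDataOfSetting.isOpen_stabilizer_units C) (EtaleThetaDataOfSetting.finiteIndex_stabilizer_units C)
            (unitGroup ℚ_[p] (PadicAlgCl p)) ρlim).MxTM),
          (m : (thetaEvaluation C hC hS hl hp2 hpl hζ mods f hf hmods h15 L hZ hcharY hlim Env I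
            (LevelRetraction.ofAugmentation (EtaleThetaDataOfSetting.phi C) (D.lDeltaTheta l)
              (EtaleThetaDataOfSetting.aug C) I.Dmu hDq (EtaleThetaDataOfSetting.PiYdd C)
              (EtaleThetaDataOfSetting.continuous_aug C) (aug_ker_acts_trivially C) hlift hemb)
            cU (EtaleThetaDataOfSetting.isOpen_stabilizer_units C) (EtaleThetaDataOfSetting.finiteIndex_stabilizer_units C)
            (unitGroup ℚ_[p] (PadicAlgCl p)) ρlim).Hd) =
              Multiplicative.toAdd (h1LimKummer (EtaleThetaDataOfSetting.phi C) (D.lDeltaTheta l) I.Dmu cU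
                (EtaleThetaDataOfSetting.isOpen_stabilizer_units C) (EtaleThetaDataOfSetting.finiteIndex_stabilizer_units C) u) →
            e (Multiplicative.ofAdd (QuotientAddGroup.mk m)) = π (QuotientGroup.mk u)} := by
  refine exists_muXmuDiagram_thetaEvaluation C hC hS hl hp2 hpl hζ mods f hf hmods h15 L hZ hcharY hlim Env I _ cU _ _
    (unitGroup ℚ_[p] (PadicAlgCl p)) ρlim (fun i k u => ?_) hcU (fun _ hu => mem_unitGroup_padic_of_isOfFinOrder hu) ?_
    A G P₀ hP₀
  · -- `hψA`: the canonical retraction preserves `ε`, and the action on `ℚ̄_pˣ` factors through `ε`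
    exact smul_units_eq_of_aug_eq C (q_retract hDq (EtaleThetaDataOfSetting.PiYdd C) i.K k) u
  · -- the Kummer map at `D_{μ_-}` is injective (abc-iut-w4-d007)
    exact EtaleThetaDataOfSetting.h1LimKummer_injective_of_coeff C (EtaleThetaDataOfSetting.phi C) (D.lDeltaTheta l) cU
      I.Dmu hcU

end Model

end EtaleLevels

end Literature.IUT.HodgeArakelov

end
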